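import Summits.Langlands.Langlands.Theorems.HalfIntegralTwistCM.Negative.ArchParameterGLOne
import HarnessLib

/-!
# `HalfIntegralTwistCM` (stmt-Langlands-14036) — negative knowledge II: the modulus of the exponents

Sorry-free (cdisprove cycle 1). For ANY number field and ANY `GL₁` datum the REAL PARTS of the archimedean
exponents are parallel — `Re c_w = σ` at real places, `Re (p_w + q_w) = 2σ` at complex places
(`exists_re_archParam_parallel_glOne`) — because `|θ| = ‖·‖^σ` for every idele class character
(`HeckeCharacter.exists_norm_apply_eq_ideleNorm_rpow`, proved in the tree from the compactness of
`𝕀¹_K/Kˣ`). This is the obstruction that makes `IsCMField` load-bearing (file `WithoutIsCMField`).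
For the provers: the COMPLETE parameter of `π_θ` for `θ` of unitary archimedean type `(m, t)`
(`archParam_of_hasUnitaryArchType`: `{i t_w}` at real `w`; `{(m_w + i t_w)/2}`, `{(-m_w + i t_w)/2}` at
`σ_w`, `σ̄_w`), the last step of the positive proof (re-twist `= ψ·‖·‖^r`, `ψ` from Weil's criterion).
[folklore]
-/

noncomputable section

open scoped MatrixGroups Matrix Classical NumberField ComplexConjugate
open NumberField NumberField.InfinitePlace NumberField.mixedEmbedding IsDedekindDomain

namespace Summit.Langlands.Langlands.Theorems.HalfIntegralTwistCM.Negative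

open Literature.NumberTheory.Automorphic
open Literature.NumberTheory.GaloisRepresentations

variable {K : Type} [Field K] [NumberField K] {hcpt : isCompact_glFiniteIntegralLevel 1 K}

/-- The idele norm of `det (exp (r·1_w), 1)` at a real place `w` is `e^r`. [folklore] -/
theorem ideleNorm_det_ofInfinite_expGL_realPlaceLie (w : {w : InfinitePlace K // w.IsReal}) (r : ℝ) :
    Literature.NumberTheory.GaloisRepresentations.ideleNorm (Matrix.GeneralLinearGroup.det (GLn.ofInfinite 1 K
      (expGL (realPlaceLie 1 w (r • (1 : Matrix (Fin 1) (Fin 1) ℝ)))))) = Real.exp r := by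
  unfold Literature.NumberTheory.GaloisRepresentations.ideleNorm
  rw [det_ofInfinite_snd]
  have hfin : ∏ᶠ v : HeightOneSpectrum (𝓞 K),
      ‖((1 : FiniteAdeleRing (𝓞 K) K) v)‖ = 1 :=
    finprod_eq_one_of_forall_eq_one fun v => by
      rw [show ((1 : FiniteAdeleRing (𝓞 K) K) v) = 1 from rfl, norm_one]
  rw [hfin, mul_one]
  have hnorm : ∀ w' : InfinitePlace K,
      ‖(((Matrix.GeneralLinearGroup.det (GLn.ofInfinite 1 K
        (expGL (realPlaceLie 1 w (r • (1 : Matrix (Fin 1) (Fin 1) ℝ))))) : (AdeleRing (𝓞 K) K)ˣ) :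
          AdeleRing (𝓞 K) K).1 w')‖ = if w' = w.1 then Real.exp r else 1 := by
    intro w'
    rw [← (Completion.isometry_extensionEmbedding w').norm_map_of_map_zero (map_zero _),
      extensionEmbedding_det_ofInfinite_expGL_realPlaceLie]
    split_ifs
    · rw [Complex.norm_real, Real.norm_eq_abs, abs_of_pos (Real.exp_pos r)]
    · exact norm_one
  simp_rw [hnorm]
  rw [Finset.prod_eq_single w.1 (fun w' _ hw' => by rw [if_neg hw', one_pow])
    (fun h => absurd (Finset.mem_univ _) h), if_pos rfl, mult_isReal, pow_one]

/-- The idele norm of `det (exp a_w, 1)` at a complex place `w` is `|e^a|² = e^{2 Re a}`. [folklore] -/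
theorem ideleNorm_det_ofInfinite_expGL_complexPlaceLie (w : {w : InfinitePlace K // w.IsComplex}) (a : ℂ) :
    Literature.NumberTheory.GaloisRepresentations.ideleNorm (Matrix.GeneralLinearGroup.det (GLn.ofInfinite 1 K
      (expGL (complexPlaceLie 1 w (a • (1 : Matrix (Fin 1) (Fin 1) ℂ)))))) = Real.exp a.re ^ 2 := by
  unfold Literature.NumberTheory.GaloisRepresentations.ideleNorm
  rw [det_ofInfinite_snd]
  have hfin : ∏ᶠ v : HeightOneSpectrum (𝓞 K),
      ‖((1 : FiniteAdeleRing (𝓞 K) K) v)‖ = 1 :=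
    finprod_eq_one_of_forall_eq_one fun v => by
      rw [show ((1 : FiniteAdeleRing (𝓞 K) K) v) = 1 from rfl, norm_one]
  rw [hfin, mul_one]
  have hnorm : ∀ w' : InfinitePlace K,
      ‖(((Matrix.GeneralLinearGroup.det (GLn.ofInfinite 1 K
        (expGL (complexPlaceLie 1 w (a • (1 : Matrix (Fin 1) (Fin 1) ℂ))))) : (AdeleRing (𝓞 K) K)ˣ) :
          AdeleRing (𝓞 K) K).1 w')‖ = if w' = w.1 then Real.exp a.re else 1 := by
    intro w'
    rw [← (Completion.isometry_extensionEmbedding w').norm_map_of_map_zero (map_zero _),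
      extensionEmbedding_det_ofInfinite_expGL_complexPlaceLie]
    split_ifs
    · exact Complex.norm_exp a
    · exact norm_one
  simp_rw [hnorm]
  rw [Finset.prod_eq_single w.1 (fun w' _ hw' => by rw [if_neg hw', one_pow])
    (fun h => absurd (Finset.mem_univ _) h), if_pos rfl, mult_isComplex]

/-- **Real parts of archimedean exponents are parallel** (any number field, any `GL₁` datum): there is
`σ ∈ ℝ` with `Re c_w = σ` at every real place (`P σ_w = {c_w}`) and `Re (p_w + q_w) = 2σ` at every
complex place (`P σ_w = {p_w}`, `P σ̄_w = {q_w}`). Proof: `|χ_π| = ‖·‖^σ`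
(`HeckeCharacter.exists_norm_apply_eq_ideleNorm_rpow`: `𝕀_K/𝕀¹_K ≅ ℝ_{>0}`, `𝕀¹_K/Kˣ` compact) evaluated
on `det (exp Y, 1)`. This is the necessity half of Weil's criterion for the MODULUS of the type, and the
obstruction behind `IsCMField`. Weil, *Basic Number Theory*, Ch. VII §3; Patrikis 2019, §2.1
(`ψ = |·|^r ·` unitary). [cite: WeilBNT1967, Ch. IV §4, Thm. 6] -/
theorem exists_re_archParam_parallel_glOne
    (π : AutomorphicRepData (AutomorphyDatum.gl 1 K hcpt)) {P : (K →+* ℂ) → Multiset ℂ}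
    (hP : π.HasArchParameter P) :
    ∃ σ : ℝ, (∀ (w : {w : InfinitePlace K // w.IsReal}) (c : ℂ), P w.1.embedding = {c} → c.re = σ) ∧
      ∀ (w : {w : InfinitePlace K // w.IsComplex}) (p q : ℂ), P w.1.embedding = {p} →
        P (ComplexEmbedding.conjugate w.1.embedding) = {q} → (p + q).re = 2 * σ := by
  obtain ⟨χ, hχ⟩ := π.exists_heckeCharacter_glOne
  obtain ⟨σ, hσ⟩ := χ.exists_norm_apply_eq_ideleNorm_rpow
  refine ⟨σ, fun w c hc => ?_, fun w p q hp hq => ?_⟩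
  · obtain ⟨c', hc', hval⟩ := archParam_realPlace_glOne π hχ hP w
    obtain rfl : c = c' := Multiset.singleton_inj.1 (hc.symm.trans hc')
    have h := hσ (Matrix.GeneralLinearGroup.det (GLn.ofInfinite 1 K
      (expGL (realPlaceLie 1 w ((1 : ℝ) • (1 : Matrix (Fin 1) (Fin 1) ℝ))))))
    rw [hval, ideleNorm_det_ofInfinite_expGL_realPlaceLie, Complex.norm_exp, ← Real.exp_mul] at h
    have h' := Real.exp_injective h
    simpa using h'
  · obtain ⟨p', q', hp', hq', hval⟩ := archParam_complexPlace_glOne π hχ hP w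
    obtain rfl : p = p' := Multiset.singleton_inj.1 (hp.symm.trans hp')
    obtain rfl : q = q' := Multiset.singleton_inj.1 (hq.symm.trans hq')
    have h := hσ (Matrix.GeneralLinearGroup.det (GLn.ofInfinite 1 K
      (expGL (complexPlaceLie 1 w ((1 : ℂ) • (1 : Matrix (Fin 1) (Fin 1) ℂ))))))
    rw [hval, ideleNorm_det_ofInfinite_expGL_complexPlaceLie, Complex.norm_exp, ← Real.exp_nat_mul,
      ← Real.exp_mul] at h
    have h' := Real.exp_injective h
    simp only [one_mul, map_one, Complex.one_re] at h'
    push_cast at h'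
    linarith

/-! ## §5 For the provers: the full parameter of `π_θ` for `θ` of unitary archimedean type, and the
## proof plan that the obstructions above leave open

`archParam_of_hasUnitaryArchType` computes the archimedean parameter of the datum of a Hecke character
of unitary type `(m, t)` COMPLETELY: `{i t_w}` at a real place, `{(m_w + i t_w)/2}` at `σ_w` and
`{(-m_w + i t_w)/2}` at `σ̄_w` at a complex place. Together with the tree's norm-twist shift
(`HasArchParameter.of_map_mulChar_detTwist`, `ArchParameterTwistNorm`) this is the last step of the
positive proof: the re-twist is `χ = ψ · ‖·‖^r` with `ψ` from Weil's criterion.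

PROOF PLAN for the crux that AVOIDS the (unformalised) necessity half of Weil's criterion — recorded
here because the disproof attempts show it is the only delicate point. Let `ω` be the datum of (iv),
`θ = χ_ω` its Hecke character (`exists_heckeCharacter_glOne`), `e = s₁ + s₂` its exponents.
(1) `θ ∘ det` has a level `𝔪 ≠ 0` (`HeckeCharacter.exists_level_glOne`, PROVED), so `θ((1, u_f)) = 1` for
units `u ≡ 1 (𝔪)`; with `θ(principal idele of u) = 1` this gives `θ((u_∞, 1)) = 1` on the congruence
subgroup `U_𝔪`, of finite index in `𝓞_Kˣ` (kernel of `𝓞_Kˣ → (𝓞_K/𝔪)ˣ`). (2) For `u ∈ U_𝔪 ∩ (𝓞_{K⁺}ˣ)²`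
(finite index: Mathlib `NumberField.IsCMField.indexRealUnits_eq_one_or_two` — THIS is where CM enters),
`u_∞ = det (exp Y, 1)` with `Y_w = log ι_w(u) ∈ ℝ`, and `archParam_complexPlace_glOne` (§2) reads
`θ((u_∞,1)) = exp (∑_w (e σ_w + e σ̄_w) log ι_w u) = 1`. (3) The wanted exponents `p = 1/2 - s₁ + N` have
`p σ_w + p σ̄_w = (1 + N + N' - j_w) - (e σ_w + e σ̄_w)/2` (`j_w ∈ ℤ` from (iii); (i) is not needed) and
`p σ_w - p σ̄_w ∈ ℤ` from (ii); choose the `N`'s with `1 + N + N' - j_w = M` constant and put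
`m_w = p σ_w - p σ̄_w`, `t_w = Im (p σ_w + p σ̄_w)·(normalisation of HeckeCharacterArchType)`,
`r = Re (p σ_w + p σ̄_w)/2` (place-independent by `exists_re_archParam_parallel_glOne` applied to `ω`).
(4) Weil's unit product for `(m, t)` on `u²`, `u` as in (2), is `exp` of HALF the exponent in (2), so it is
`1` on a finite-index subgroup, hence of finite order `M` on all of `𝓞_Kˣ`: the hypothesis of
`Patrikis2019_heckeCharacter_archType_iff_units` (⇐) holds; get `ψ`. (5) `χ := π_{ψ·‖·‖^r}`
(`exists_automorphicRepData_detTwist_glOne`), parameter by `archParam_of_hasUnitaryArchType` + norm shift.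
Inputs beyond the tree: ONLY the named fact of (4). -/

/-- `archUnitaryValue m t (e^s) = e^{i s t}` for real `s` (the modulus character of `ℂˣ` / `ℝˣ` on the
positive reals). [folklore] -/
theorem archUnitaryValue_ofReal_exp (m : ℤ) (t : ℝ) (s : ℝ) :
    archUnitaryValue m t ((Real.exp s : ℝ) : ℂ) = Complex.exp (s * (t * Complex.I)) := by
  unfold archUnitaryValue
  have hpos : (0 : ℝ) < Real.exp s := Real.exp_pos s
  have hne : ((Real.exp s : ℝ) : ℂ) ≠ 0 := by exact_mod_cast hpos.ne'
  rw [Complex.norm_real, Real.norm_eq_abs, abs_of_pos hpos, div_self hne, one_zpow, one_mul,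
    Complex.cpow_def_of_ne_zero hne, Complex.ofReal_exp, Complex.log_exp (by simp [Real.pi_pos])
      (by simpa using Real.pi_pos.le)]

/-- **The archimedean parameter of `π_θ` for `θ` of unitary archimedean type `(m, t)`** (complete form
of `archParam_sub_conj_eq_of_hasUnitaryArchType`): at a real place `w`, `P σ_w = {i t_w}`; at a complex
place `w`, `P σ_w = {(m_w + i t_w)/2}` and `P σ̄_w = {(-m_w + i t_w)/2}`. (`θ_w = (z/|z|)^{m} |z|^{it}`
`= z^{(m+it)/2} z̄^{(-m+it)/2}`; at a real place the sign character is infinitesimally invisible.)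
Tate (1950), §2.3; Clozel 1990, §3.3; Patrikis 2019, §2.1. [cite: Patrikis2019, §2.1 (display before Lemma 2.1.1)] -/
theorem archParam_of_hasUnitaryArchType
    (π : AutomorphicRepData (AutomorphyDatum.gl 1 K hcpt)) {θ : HeckeCharacter K}
    (hχ : ∀ (g : (AdelicGroupData.gl 1 K).Adelic), ∀ φ ∈ π.W,
      rightTranslation (AdelicGroupData.gl 1 K) g φ -
        ((θ (Matrix.GeneralLinearGroup.det g) : ℂˣ) : ℂ) • φ ∈ π.W')
    {m : InfinitePlace K → ℤ} {t : InfinitePlace K → ℝ} (hθ : θ.HasUnitaryArchType m t)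
    {P : (K →+* ℂ) → Multiset ℂ} (hP : π.HasArchParameter P) :
    (∀ w : {w : InfinitePlace K // w.IsReal}, P w.1.embedding = {(t w.1 : ℂ) * Complex.I}) ∧
      ∀ w : {w : InfinitePlace K // w.IsComplex},
        P w.1.embedding = {((m w.1 : ℂ) + t w.1 * Complex.I) / 2} ∧
          P (ComplexEmbedding.conjugate w.1.embedding) = {(-(m w.1 : ℂ) + t w.1 * Complex.I) / 2} := by
  refine ⟨fun w => ?_, fun w => ?_⟩
  · -- real place
    obtain ⟨c, hc, hval⟩ := archParam_realPlace_glOne π hχ hP w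
    have key : ∀ s : ℝ, Complex.exp (s * c) = Complex.exp (s * (t w.1 * Complex.I)) := by
      intro s
      have hx := hθ (HeckeCharacter.infPart K (Matrix.GeneralLinearGroup.det (GLn.ofInfinite 1 K
        (expGL (realPlaceLie 1 w (s • (1 : Matrix (Fin 1) (Fin 1) ℝ)))))))
      rw [infiniteIdeles_infPart_det_ofInfinite_expGL] at hx
      simp only [HeckeCharacter.val_infPart] at hx
      simp_rw [extensionEmbedding_det_ofInfinite_expGL_realPlaceLie K w] at hx
      rw [Finset.prod_eq_single w.1 (fun w' _ hw' => by rw [if_neg hw', archUnitaryValue_one])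
        (fun h => absurd (Finset.mem_univ _) h), if_pos rfl, archUnitaryValue_ofReal_exp] at hx
      rw [← hval s, hx]
    rw [hc, eq_of_forall_cexp_mul_eq key]
  · -- complex place
    obtain ⟨p, q, hp, hq, hval⟩ := archParam_complexPlace_glOne π hχ hP w
    obtain ⟨p', q', hp', hq', hdiff⟩ := archParam_sub_conj_eq_of_hasUnitaryArchType π hχ hθ hP w
    obtain rfl : p = p' := Multiset.singleton_inj.1 (hp.symm.trans hp')
    obtain rfl : q = q' := Multiset.singleton_inj.1 (hq.symm.trans hq')
    have hsum : p + q = t w.1 * Complex.I := by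
      refine eq_of_forall_cexp_mul_eq fun s => ?_
      have hx := hθ (HeckeCharacter.infPart K (Matrix.GeneralLinearGroup.det (GLn.ofInfinite 1 K
        (expGL (complexPlaceLie 1 w ((s : ℂ) • (1 : Matrix (Fin 1) (Fin 1) ℂ)))))))
      rw [infiniteIdeles_infPart_det_ofInfinite_expGL] at hx
      simp only [HeckeCharacter.val_infPart] at hx
      simp_rw [extensionEmbedding_det_ofInfinite_expGL_complexPlaceLie K w] at hx
      rw [Finset.prod_eq_single w.1 (fun w' _ hw' => by rw [if_neg hw', archUnitaryValue_one])
        (fun h => absurd (Finset.mem_univ _) h), if_pos rfl, ← Complex.ofReal_exp,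
        archUnitaryValue_ofReal_exp] at hx
      have h := hval s
      rw [Complex.conj_ofReal] at h
      rw [show (s : ℂ) * (p + q) = s * p + s * q by ring, ← h, hx]
    refine ⟨?_, ?_⟩
    · rw [hp]
      congr 1
      linear_combination (hsum + hdiff) / 2
    · rw [hq]
      congr 1
      linear_combination (hsum - hdiff) / 2

end Summit.Langlands.Langlands.Theorems.HalfIntegralTwistCM.Negative
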